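import Mathlib
import Summits.MatrixMultiplication.MatrixMultiplication.Theses.LevelGradedCohnUmans
import Literature.RepresentationTheory.FiniteGroups.IrreducibleCharacters
import Summits.MatrixMultiplication.MatrixMultiplication.Theorems.GradedDesignFamily.Negative.ExponentTwoEndpoint

/-!
# Line `tiling-families`, stub 1: tiling universality (`stub_tilingUniversality`)

Route `LevelGradedCohnUmans`, crux `GradedDesignFamily` (stmt-MatrixMultiplication-7610), line
`tiling-families` (Cruxes/GradedDesignFamily/Lines/tiling-families.md).

A `(λ, η)`-TILING FAMILY is a finite group `G`, a bi-invariant test space `J ≤ ℂ^G` with positive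
graded dimension `D = Σ_{χ ∈ Irr G ∩ J} χ(1)²`, and a simultaneously `J`-separated family of blocks
`(X_i, Y_i, Z_i)_{i<t}` with block-to-dimension ratio `λ` (`(λ·χ(1))³ ≤ V_i` for every visible
`χ`, `V_i = |X_i||Y_i||Z_i|`) and tiling efficiency `η` (`η·D ≤ Σ_i V_i^{2/3}`).  The stub: if for
ONE fixed `λ > 1` such families exist for EVERY `η < 1`, then for every `ε > 0` there is a
simultaneously separated family beating the graded budget at exponent `2 + ε` (the hypothesis of
the landed wreath lift `gradedWreathLinkAt`).

Proof ("certificate on the finite core"): everything is decided on the finite set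
`S = Irr G ∩ J` of visible characters.  With `d = max_S χ(1) ≥ 1` one has the two certificate
inequalities `B_{2+ε} = Σ_S χ(1)^{2+ε} ≤ d^ε·D` and `V_i^{(2+ε)/3} ≥ (λd)^ε·V_i^{2/3}`, whence
`Σ_i V_i^{(2+ε)/3} ≥ (λd)^ε·η·D ≥ λ^ε η·B_{2+ε}`; choosing `η = λ^{-ε/2}` gives the factor
`λ^{ε/2} > 1`, and `B_{2+ε} ≥ D > 0` makes the inequality strict (`tilingCore`).
-/

noncomputable section

set_option linter.dupNamespace false

open scoped BigOperators
open Literature.RepresentationTheory.FiniteGroups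

namespace Summit.MatrixMultiplication.MatrixMultiplication.Theorems.GradedDesignFamily

/-- **The finite core of tiling universality.**  On a finite set `S` of "characters" with degrees
`d ≥ 1` and positive dimension `D = Σ_S d²`, blocks of volumes `v_i ≥ (λ·d_χ)³` for all `χ ∈ S`
filling `η·D ≤ Σ_i v_i^{2/3}` with `η = (λ^{ε/2})⁻¹` beat the budget `Σ_S d^{2+ε}` strictly at
exponent `(2+ε)/3`. [folklore] -/
theorem tilingCore {κ ι : Type*} (S : Finset κ) (T : Finset ι) (d : κ → ℝ) (v : ι → ℝ)
    (lam ε : ℝ) (hlam : 1 < lam) (hε : 0 < ε)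
    (hd : ∀ χ ∈ S, 1 ≤ d χ) (hD : 0 < ∑ χ ∈ S, d χ ^ (2 : ℝ))
    (hblk : ∀ i ∈ T, ∀ χ ∈ S, (lam * d χ) ^ (3 : ℕ) ≤ v i)
    (hη : (lam ^ (ε / 2))⁻¹ * ∑ χ ∈ S, d χ ^ (2 : ℝ) ≤ ∑ i ∈ T, v i ^ ((2 : ℝ) / 3)) :
    ∑ χ ∈ S, d χ ^ (2 + ε) < ∑ i ∈ T, v i ^ ((2 + ε) / 3) := by
  -- the finite core is non-empty: pick a character of maximal degree
  have hSne : S.Nonempty := by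
    by_contra hS
    rw [Finset.not_nonempty_iff_eq_empty] at hS
    rw [hS, Finset.sum_empty] at hD
    exact lt_irrefl _ hD
  obtain ⟨χm, hχm, hmax⟩ := Finset.exists_max_image S d hSne
  set dm : ℝ := d χm with hdm_def
  have hdm1 : 1 ≤ dm := hd χm hχm
  have hdm0 : 0 ≤ dm := zero_le_one.trans hdm1
  have hlam0 : 0 ≤ lam := zero_le_one.trans hlam.le
  have hlampos : 0 < lam := zero_lt_one.trans hlam
  set μ : ℝ := lam ^ (ε / 2) with hμ_def
  have hμ1 : 1 < μ := Real.one_lt_rpow hlam (by linarith)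
  have hμ0 : 0 < μ := zero_lt_one.trans hμ1
  have hlamε : lam ^ ε = μ * μ := by
    rw [hμ_def, ← Real.rpow_add hlampos]; congr 1; ring
  -- certificate 1: the budget at exponent `2 + ε` is at most `dm^ε · D` ...
  have hB : ∑ χ ∈ S, d χ ^ (2 + ε) ≤ dm ^ ε * ∑ χ ∈ S, d χ ^ (2 : ℝ) := by
    rw [Finset.mul_sum]
    refine Finset.sum_le_sum fun χ hχ => ?_
    have h1 := hd χ hχ
    have h0 : 0 < d χ := zero_lt_one.trans_le h1
    rw [Real.rpow_add h0, mul_comm]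
    exact mul_le_mul_of_nonneg_right
      (Real.rpow_le_rpow h0.le (hmax χ hχ) hε.le) (Real.rpow_nonneg h0.le _)
  -- ... and at least `D > 0`
  have hDB : ∑ χ ∈ S, d χ ^ (2 : ℝ) ≤ ∑ χ ∈ S, d χ ^ (2 + ε) :=
    Finset.sum_le_sum fun χ hχ =>
      Real.rpow_le_rpow_of_exponent_le (hd χ hχ) (by linarith)
  have hBpos : 0 < ∑ χ ∈ S, d χ ^ (2 + ε) := hD.trans_le hDB
  -- certificate 2: each block gains the factor `(λ·dm)^ε` between exponents `2/3` and `(2+ε)/3`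
  have hV : ∀ i ∈ T, (lam * dm) ^ ε * v i ^ ((2 : ℝ) / 3) ≤ v i ^ ((2 + ε) / 3) := by
    intro i hi
    have hb := hblk i hi χm hχm
    have hc0 : 0 ≤ lam * dm := mul_nonneg hlam0 hdm0
    have hc3 : 0 < (lam * dm) ^ (3 : ℕ) := by positivity
    have hv0 : 0 < v i := hc3.trans_le hb
    have hsplit : v i ^ ((2 + ε) / 3) = v i ^ ((2 : ℝ) / 3) * v i ^ (ε / 3) := by
      rw [← Real.rpow_add hv0]; congr 1; ring
    rw [hsplit, mul_comm]
    refine mul_le_mul_of_nonneg_left ?_ (Real.rpow_nonneg hv0.le _)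
    have h3 : ((lam * dm) ^ (3 : ℕ)) ^ (ε / 3) = (lam * dm) ^ ε := by
      rw [← Real.rpow_natCast _ 3, ← Real.rpow_mul hc0]; congr 1; push_cast; ring
    rw [← h3]
    exact Real.rpow_le_rpow hc3.le hb (by linarith)
  -- assemble
  calc ∑ χ ∈ S, d χ ^ (2 + ε)
      < μ * ∑ χ ∈ S, d χ ^ (2 + ε) := lt_mul_of_one_lt_left hBpos hμ1
    _ ≤ μ * (dm ^ ε * ∑ χ ∈ S, d χ ^ (2 : ℝ)) := mul_le_mul_of_nonneg_left hB hμ0.le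
    _ = (lam * dm) ^ ε * (μ⁻¹ * ∑ χ ∈ S, d χ ^ (2 : ℝ)) := by
        rw [Real.mul_rpow hlam0 hdm0, hlamε]
        field_simp
    _ ≤ (lam * dm) ^ ε * ∑ i ∈ T, v i ^ ((2 : ℝ) / 3) :=
        mul_le_mul_of_nonneg_left hη (Real.rpow_nonneg (mul_nonneg hlam0 hdm0) _)
    _ = ∑ i ∈ T, (lam * dm) ^ ε * v i ^ ((2 : ℝ) / 3) := Finset.mul_sum _ _ _
    _ ≤ ∑ i ∈ T, v i ^ ((2 + ε) / 3) := Finset.sum_le_sum hV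

/-- **Stub 1 of line `tiling-families` (`stub_tilingUniversality`)**: `(λ, η)`-tiling families
for one fixed `λ > 1` and every `η < 1` yield, for every `ε > 0`, a simultaneously `J`-separated
family whose total `Σ_i V_i^{(2+ε)/3}` strictly exceeds the graded budget `Σ_{Irr ∩ J} χ(1)^{2+ε}`
— the hypothesis of the landed wreath lift `gradedWreathLinkAt`.  Take `η = λ^{-ε/2}` and apply
the finite-core certificate `tilingCore` on `S = Irr G ∩ J`. [folklore] -/
theorem stub_tilingUniversality
    (h : ∃ lam : ℝ, 1 < lam ∧ ∀ η : ℝ, η < 1 → ∃ (G : Type) (_ : Group G) (_ : Fintype G)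
      (J : Submodule ℂ (G → ℂ)) (t : ℕ) (X Y Z : Fin t → Finset G),
      (∀ f ∈ J, ∀ a b : G, (fun g : G => f (a * g * b)) ∈ J) ∧
      (∀ i : Fin t, ∀ x₀ ∈ X i, ∀ z₀ ∈ Z i, ∃ f ∈ J, ∀ a b : Fin t, ∀ x ∈ X a, ∀ y ∈ Y a,
        ∀ y' ∈ Y b, ∀ z ∈ Z b,
          ((a = i ∧ b = i ∧ x = x₀ ∧ y = y' ∧ z = z₀) → f (x⁻¹ * y * y'⁻¹ * z) = 1) ∧
          (¬ (a = i ∧ b = i ∧ x = x₀ ∧ y = y' ∧ z = z₀) → f (x⁻¹ * y * y'⁻¹ * z) = 0)) ∧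
      (0 < ∑ᶠ χ ∈ Literature.RepresentationTheory.FiniteGroups.irrChars G ∩ (J : Set (G → ℂ)),
        (χ 1).re ^ (2 : ℝ)) ∧
      (∀ i : Fin t, ∀ χ ∈ Literature.RepresentationTheory.FiniteGroups.irrChars G ∩
        (J : Set (G → ℂ)),
          (lam * (χ 1).re) ^ (3 : ℕ) ≤ (((X i).card * (Y i).card * (Z i).card : ℕ) : ℝ)) ∧
      (η * ∑ᶠ χ ∈ Literature.RepresentationTheory.FiniteGroups.irrChars G ∩ (J : Set (G → ℂ)),
        (χ 1).re ^ (2 : ℝ) ≤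
          ∑ i, (((X i).card * (Y i).card * (Z i).card : ℕ) : ℝ) ^ ((2 : ℝ) / 3)))
    (ε : ℝ) (hε : 0 < ε) :
    ∃ (G : Type) (_ : Group G) (_ : Fintype G) (J : Submodule ℂ (G → ℂ)) (t : ℕ)
      (X Y Z : Fin t → Finset G),
      (∀ f ∈ J, ∀ a b : G, (fun g : G => f (a * g * b)) ∈ J) ∧
      (∀ i : Fin t, ∀ x₀ ∈ X i, ∀ z₀ ∈ Z i, ∃ f ∈ J, ∀ a b : Fin t, ∀ x ∈ X a, ∀ y ∈ Y a,
        ∀ y' ∈ Y b, ∀ z ∈ Z b,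
          ((a = i ∧ b = i ∧ x = x₀ ∧ y = y' ∧ z = z₀) → f (x⁻¹ * y * y'⁻¹ * z) = 1) ∧
          (¬ (a = i ∧ b = i ∧ x = x₀ ∧ y = y' ∧ z = z₀) → f (x⁻¹ * y * y'⁻¹ * z) = 0)) ∧
      (∑ᶠ χ ∈ Literature.RepresentationTheory.FiniteGroups.irrChars G ∩ (J : Set (G → ℂ)),
        (χ 1).re ^ (2 + ε)) <
        ∑ i, (((X i).card * (Y i).card * (Z i).card : ℕ) : ℝ) ^ ((2 + ε) / 3) := by
  obtain ⟨lam, hlam, hfam⟩ := h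
  -- the tiling efficiency forced at exponent `ε`
  have hη1 : (lam ^ (ε / 2))⁻¹ < 1 :=
    inv_lt_one_of_one_lt₀ (Real.one_lt_rpow hlam (by linarith))
  obtain ⟨G, _instG, _instF, J, t, X, Y, Z, hJ, hsep, hD, hblk, hη⟩ := hfam _ hη1
  refine ⟨G, _instG, _instF, J, t, X, Y, Z, hJ, hsep, ?_⟩
  -- pass to the finite core `S = Irr G ∩ J`
  have hfin : (irrChars G ∩ (J : Set (G → ℂ))).Finite :=
    (irrChars_finite_holds G).subset Set.inter_subset_left
  rw [finsum_mem_eq_finite_toFinset_sum _ hfin] at hD hη ⊢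
  exact tilingCore hfin.toFinset Finset.univ (fun χ => (χ 1).re)
    (fun i => (((X i).card * (Y i).card * (Z i).card : ℕ) : ℝ)) lam ε hlam hε
    (fun χ hχ => Negative.one_le_re_apply_one (hfin.mem_toFinset.1 hχ).1) hD
    (fun i _ χ hχ => hblk i χ (hfin.mem_toFinset.1 hχ)) hη

end Summit.MatrixMultiplication.MatrixMultiplication.Theorems.GradedDesignFamily
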